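import Summits.HodgeConjecture.HodgeConjecture.Theorems.KugaSatakeSaturationTargetGlue

/-!
# Route KugaSatakeSaturation — `Assembly` (assembly item stmt-HodgeConjecture-9377)

The assembly item of route `KugaSatakeSaturation`,

  Saturation → KSDescent → Transfer → SectorComplement → HodgeConjecture,

is the route's deciding theorem `closes (h₁ : Saturation) (h₂ : KSDescent) (h₃ : Transfer)
(h₄ : TargetGlue) (h₅ : SectorComplement)` with its glue hypothesis `TargetGlue` discharged by the
tree's `kugaSatakeSaturation_targetGlue_proof` (pure logic, file `KugaSatakeSaturationTargetGlue`).
No named-fact hypothesis, no sorry.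
-/

-- `Summit.HodgeConjecture.HodgeConjecture.Theorems` is the mandated namespace (single-problem
-- summit: Problem = Summit), which `linter.dupNamespace` flags on every declaration; the lakefile
-- turns the linter off tree-wide (weak option), restated here so stand-alone elaboration is
-- warning-free too.
set_option linter.dupNamespace false

namespace Summit.HodgeConjecture.HodgeConjecture.Theorems

/-- **Item stmt-HodgeConjecture-9377 (`Assembly`), route `KugaSatakeSaturation`**:
`Saturation → KSDescent → Transfer → SectorComplement → HodgeConjecture` — the route's deciding
theorem `closes` with its glue hypothesis `TargetGlue` discharged by
`kugaSatakeSaturation_targetGlue_proof`.  The type is the route decl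
`Summit.HodgeConjecture.HodgeConjecture.Theses.KugaSatakeSaturation.Assembly`. -/
theorem kugaSatakeSaturation_assembly_proof :
    Summit.HodgeConjecture.HodgeConjecture.Theses.KugaSatakeSaturation.Assembly :=
  fun h₁ h₂ h₃ h₅ ↦ Summit.HodgeConjecture.HodgeConjecture.Theses.KugaSatakeSaturation.closes h₁ h₂ h₃
    kugaSatakeSaturation_targetGlue_proof h₅

end Summit.HodgeConjecture.HodgeConjecture.Theorems
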